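import Literature.AnabelianGeometry.AbsoluteAnabelian.MLFGaloisGroups
import Literature.NumberTheory.GaloisRepresentations.LocalExistenceTameProofs
import Literature.NumberTheory.GaloisRepresentations.TameInertiaKummerProofs
import HarnessLib

/-!
# Bridge: the elementary residue cardinality `residueCardMLF` of `MLFGaloisGroups.lean` is the
# residue cardinality of the valued model

abc-iut-L4-t4's `MLFGaloisGroups.lean` defines, for an MLF `K` in the `ℚ_p`-binder model,
`residueCardMLF p K = #μ_{(p')}(K) + 1` — the number of roots of unity of `K` of order prime to `p`,
plus one — as an ELEMENTARY stand-in for `|k| = q` (Teichmüller: `μ_{(p')}(K) ≅ k^×`, Serre, *Local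
Fields*, Ch. II §4, Prop. 8).  This proof-only file proves that stand-in correct in the tree's
valued model: for a non-archimedean local field `F` of residue characteristic `p`,

* `eq_one_of_pow_eq_one_of_sub_one_mem_maximalIdeal` — a root of unity of order prime to `p` in
  `𝒪_F` which is `≡ 1 (mod 𝔪_F)` equals `1`;
* `primeToRootsOfUnity_eq_nthRootsFinset` — `μ_{(p')}(F) = μ_{q-1}(F)`;
* `natCard_primeToRootsOfUnity_eq` — `#μ_{(p')}(F) = q - 1` (the tree PROVES that `F` contains a
  primitive `(q-1)`-th root of unity, `exists_isPrimitiveRoot_residueFieldCard_sub_one`);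
* `residueCardMLF_eq_residueFieldCard` — **`residueCardMLF p F = residueFieldCard F = |k_F|`**.

Consumed by the discharge of `mlf_unramified_criterion` (`MLFReciprocityInputs.lean`) and by every
comparison of the `ℚ_p`-binder statements of [AbsAnab] Prop 1.2.1 with the valued-model class
field theory (via the PROVED bridge `FiniteExtension.isNonarchimedeanLocalField ℚ_[p] K`).
Proof-only: no definitions.
-/

noncomputable section

open scoped Valued
open ValuativeRel Field Polynomial

namespace Literature.AnabelianGeometry.AbsoluteAnabelian

open Literature.NumberTheory.GaloisRepresentations
open Literature.NumberTheory.GaloisRepresentations.IsNonarchimedeanLocalField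

variable {F : Type} [Field F] [ValuativeRel F] [TopologicalSpace F] [IsNonarchimedeanLocalField F]

/-- **Roots of unity of order prime to `p` are distinct modulo `𝔪`** (in `𝒪_F`): if `η ∈ 𝒪_F`,
`η ^ N = 1` with `N` a unit of `𝒪_F`, and `η ≡ 1 (mod 𝔪_F)`, then `η = 1`.  (`η^N - 1 = (η - 1) s`
with `s = ∑_{i<N} η^i ≡ N`, a unit.)  Serre, *Local Fields*, Ch. II §4, Prop. 8 (uniqueness of the
multiplicative representative). [cite: SerreLocalFields1979, Ch. II §4 Prop. 8] -/
theorem eq_one_of_pow_eq_one_of_sub_one_mem_maximalIdeal {N : ℕ} (hN : IsUnit ((N : ℕ) : 𝒪[F]))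
    {η : 𝒪[F]} (hη : η ^ N = 1) (h1 : η - 1 ∈ 𝓂[F]) : η = 1 := by
  -- `s = ∑_{i<N} η^i` is a unit: `s - N ∈ 𝔪`
  set s : 𝒪[F] := ∑ i ∈ Finset.range N, η ^ i with hs
  have hsN : s - (N : 𝒪[F]) ∈ 𝓂[F] := by
    have : s - (N : 𝒪[F]) = ∑ i ∈ Finset.range N, (η ^ i - 1) := by
      rw [Finset.sum_sub_distrib, Finset.sum_const, Finset.card_range, nsmul_eq_mul, mul_one]
    rw [this]
    refine Ideal.sum_mem _ fun i _ => ?_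
    have hdvd : η - 1 ∣ η ^ i - 1 := sub_one_dvd_pow_sub_one η i
    obtain ⟨c, hc⟩ := hdvd
    rw [hc]
    exact Ideal.mul_mem_right _ _ h1
  have hsu : IsUnit s := by
    by_contra hns
    have hsm : s ∈ 𝓂[F] := (IsLocalRing.mem_maximalIdeal _).mpr hns
    have hNm : (N : 𝒪[F]) ∈ 𝓂[F] := by
      have := Ideal.sub_mem _ hsm hsN
      rwa [sub_sub_cancel] at this
    exact (IsLocalRing.mem_maximalIdeal _).mp hNm hN
  -- `(η - 1) * s = η^N - 1 = 0`
  have hprod : s * (η - 1) = 0 := by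
    rw [hs, geom_sum_mul, hη, sub_self]
  rw [mul_comm] at hprod
  have := (mul_eq_zero.mp hprod).resolve_right hsu.ne_zero
  exact sub_eq_zero.mp this

omit [TopologicalSpace F] [IsNonarchimedeanLocalField F] in
/-- A root of unity of `F` lies in `𝒪_F` with valuation `1`. [folklore] -/
private theorem valuation_eq_one_of_pow_eq_one {η : F} {n : ℕ} (hn : 0 < n) (hη : η ^ n = 1) :
    valuation F η = 1 := by
  have h := congrArg (valuation F) hη
  rw [map_pow, map_one] at h
  exact (pow_eq_one_iff.mp h).resolve_right hn.ne'

/-- The residue cardinality `q` is divisible by the residue characteristic; hence `p ∤ q - 1` and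
`q - 1` is a unit of `𝒪_F`. [folklore] -/
private theorem not_ringChar_dvd_residueFieldCard_sub_one :
    ¬ ringChar 𝓀[F] ∣ residueFieldCard F - 1 := by
  intro h
  have hq : ringChar 𝓀[F] ∣ residueFieldCard F := by
    rw [← ringChar.spec, cast_residueFieldCard_eq_zero]
  have h1 : ringChar 𝓀[F] ∣ 1 := by
    have := (Nat.dvd_sub_iff_right (Nat.one_le_iff_ne_zero.mpr (residueFieldCard_ne_zero F)) hq).mp h
    simpa using this
  exact CharP.ringChar_ne_one (Nat.dvd_one.mp h1)

/-- **`μ_{(p')}(F) = μ_{q-1}(F)`**: a root of unity `η ∈ F` of order prime to `p` satisfies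
`η ^ (q - 1) = 1` (its `(q-1)`-th power is a root of unity of order prime to `p` congruent to `1`),
and conversely `p ∤ q - 1`.  Serre, *Local Fields*, Ch. II §4, Prop. 8.
[cite: SerreLocalFields1979, Ch. II §4 Prop. 8] -/
theorem primeToRootsOfUnity_eq_nthRootsFinset {p : ℕ} [Fact p.Prime] (hp : ringChar 𝓀[F] = p) :
    primeToRootsOfUnity p F = ↑(nthRootsFinset (residueFieldCard F - 1) (1 : F)) := by
  have hq1 : 1 < residueFieldCard F := one_lt_residueFieldCard F
  have hq0 : 0 < residueFieldCard F - 1 := by omega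
  have hpq : ¬ p ∣ residueFieldCard F - 1 := hp ▸ not_ringChar_dvd_residueFieldCard_sub_one
  ext η
  rw [Finset.mem_coe, Polynomial.mem_nthRootsFinset hq0]
  constructor
  · rintro ⟨n, hn, hpn, hηn⟩
    -- `η ∈ 𝒪_F^×`; `η' = η^(q-1)` is an `n`-th root of unity `≡ 1 (mod 𝔪)`
    have hv : valuation F η = 1 := valuation_eq_one_of_pow_eq_one hn hηn
    set η₀ : 𝒪[F] := ⟨η, by rw [Valuation.mem_integer_iff, hv]⟩ with hη₀
    have hη₀v : valuation F (η₀ : F) = 1 := hv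
    have h1 : η₀ ^ (residueFieldCard F - 1) - 1 ∈ 𝓂[F] :=
      pow_residueFieldCard_sub_one_sub_one_mem hη₀v
    have hpow : (η₀ ^ (residueFieldCard F - 1)) ^ n = 1 := by
      apply Subtype.ext
      rw [SubmonoidClass.coe_pow, SubmonoidClass.coe_pow, ← pow_mul, mul_comm, pow_mul, hηn,
        one_pow, OneMemClass.coe_one]
    have hnu : IsUnit ((n : ℕ) : 𝒪[F]) :=
      isUnit_natCast_of_not_ringChar_dvd F (hp ▸ hpn)
    have := eq_one_of_pow_eq_one_of_sub_one_mem_maximalIdeal hnu hpow h1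
    have h2 := congrArg (fun x : 𝒪[F] => (x : F)) this
    simpa [SubmonoidClass.coe_pow] using h2
  · intro hη
    exact ⟨residueFieldCard F - 1, hq0, hpq, hη⟩

/-- **`#μ_{(p')}(F) = q - 1`**: `F` contains a primitive `(q-1)`-th root of unity (Teichmüller /
Hensel, `exists_isPrimitiveRoot_residueFieldCard_sub_one`), so `μ_{q-1}(F)` has exactly `q - 1`
elements.  Serre, *Local Fields*, Ch. II §4, Prop. 8. [cite: SerreLocalFields1979, Ch. II §4 Prop. 8] -/
theorem natCard_primeToRootsOfUnity_eq {p : ℕ} [Fact p.Prime] (hp : ringChar 𝓀[F] = p) :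
    Nat.card (primeToRootsOfUnity p F) = residueFieldCard F - 1 := by
  obtain ⟨ζ, hζ⟩ := exists_isPrimitiveRoot_residueFieldCard_sub_one F
  rw [primeToRootsOfUnity_eq_nthRootsFinset hp, Nat.card_coe_set_eq, Set.ncard_coe_finset,
    hζ.card_nthRootsFinset]

/-- **`residueCardMLF p F = |k_F|`**: the elementary residue cardinality `#μ_{(p')}(F) + 1` of
`MLFGaloisGroups.lean` equals the cardinality `residueFieldCard F` of the residue field of the
valued model (for `F` of residue characteristic `p`).  Serre, *Local Fields*, Ch. II §4, Prop. 8
(`μ_{q-1} ≅ k^×`). [cite: SerreLocalFields1979, Ch. II §4 Prop. 8] -/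
theorem residueCardMLF_eq_residueFieldCard {p : ℕ} [Fact p.Prime] (hp : ringChar 𝓀[F] = p) :
    residueCardMLF p F = residueFieldCard F := by
  rw [residueCardMLF, natCard_primeToRootsOfUnity_eq hp]
  have := one_lt_residueFieldCard F
  omega

end Literature.AnabelianGeometry.AbsoluteAnabelian
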